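import Literature.NumberTheory.Automorphic.UnitaryGroupArithmeticLevels
import Literature.NumberTheory.Automorphic.UnitaryGroupEllipticGeneratorBounded
import Mathlib.NumberTheory.NumberField.Units.DirichletTheorem
import Mathlib.NumberTheory.NumberField.CMField
import Mathlib.Algebra.Polynomial.SpecificDegree
import HarnessLib

/-!
# A hermitian plane indefinite at TWO real places: its congruence subgroups are NOT discrete at either place

Topic `Literature/NumberTheory/Automorphic`, namespace `Literature.NumberTheory.Automorphic.UnitaryGroup.TwoIndefinitePlaces`.
Cell `hodgecm-mathlib`, FLOOR 0, crux item stmt-HodgeConjecture-24832 (hLiu418), E-line socket `stub_SIG`, line L5, organ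
`stub_GEN` («NOREC: no record system uniformises a fake-signature form» — the NUMBER-THEORY half; the record half is ★
`UnitaryShimuraCurveRecordDiscrete`, the orbit-of-the-generator half is ★ `UnitaryGroupEllipticGeneratorBounded`).  THEOREMS ONLY
(no definition, no named fact, no instance, no `sorry`).

THE MATHEMATICS.  Let `F` be a CM field with maximal real subfield `F⁺` and involution `c`, `J ∈ M₂(F)` hermitian, and
`ι₁, σ : F → ℂ` two complex embeddings defining DIFFERENT places at which `J` is INDEFINITE (`det J^{ι₁} < 0`, `det J^σ < 0`;
for a hermitian plane, indefinite ⟺ negative determinant).  Then the arithmetic subgroups of `U(J)(F⁺)` are NOT discrete in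
`U(J^{ι₁}) ≅ U(1,1)`: every principal congruence subgroup `Γ_J(n)` has INFINITELY many elements whose `ι₁`-entries are bounded.
Classically this is the statement that an irreducible lattice in `U(1,1)² × (compact)` has non-discrete projections, or that a
quaternion order gives a Fuchsian group only when the algebra is ramified at all other real places (Maclachlan–Reid, *The
arithmetic of hyperbolic 3-manifolds*, §8.1–8.2; Katok, *Fuchsian groups*, Ch. 5).  HERE it is proved ELEMENTARILY from
Dirichlet's unit theorem (Mathlib `NumberField.Units.dirichletUnitTheorem.exists_unit`):

* §1–§3 (the torus): for a `J`-SKEW matrix `X₀` (`(X₀^c)ᵀ J = −J X₀`) with `X₀² = β ∈ F⁺`, the elements `x + y X₀`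
  (`x, y ∈ F⁺`) satisfy `((x + yX₀)^c)ᵀ J (x + yX₀) = (x² − β y²) J`: the norm-one torus of `F⁺(√β)` sits in `U(J)`; for `ι₁ β < 0`
  the relation `(ι₁x)² + |ι₁β| (ι₁y)² = 1` BOUNDS the `ι₁`-entries (the torus is compact at `ι₁`).
* §4 (`exists_pell_seq`, PELL WITH CONGRUENCES): for an algebraic integer `β` of a number field `k`, negative at a real
  embedding `ρ₁` and positive at another `ρ₂`, and `n ≠ 0`, there is an injective sequence of solutions of `x² − β y² = 1` in
  `k` with `x ≡ 1`, `y ≡ 0 (mod n)` integrally: `K = k[X]/(X² − β)` (Mathlib `AdjoinRoot`, a number field) has a real place `w₂`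
  over `ρ₂`; Dirichlet's unit `ε` at `w₂` gives the relative-norm-one unit `u = ε/ε̄` with `|u|_{w₂} > 1`; the coordinates of its
  powers have denominators dividing `2β` (traces), pigeonhole modulo `n(2β)²` (`Ideal.finiteQuotientOfFreeOfNeBot`) produces
  `v` with coordinates `≡ (1, 0) mod n`, whose powers are the sequence.
* §5 (the frame): a 3-case Gram–Schmidt diagonalisation `(P^c)ᵀ J P = diag(p, r)` (`exists_diag_frame`), the `diag(p,r)`-skew
  traceless `M = (δ, −(r/p)y; y, −δ)` with `M² = (δ² − (r/p)y²)·1` (`δ` `c`-anti-fixed, `y ∈ F⁺`), transport of skewness along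
  the frame, and the choice of `y ∈ F⁺` SMALL at `ι₁|F⁺` and LARGE at `σ|F⁺` (`exists_abs_lt_lt_abs`: `y = N(z − q)` with `z ∈ F⁺`
  separating the two embeddings — `IsCMField.equivInfinitePlace` — and `q ∈ ℚ` close to `ι₁ z`), so that
  `β = δ² − (r/p) y²` has `ι₁ β < 0 < σ β`.
* §6 MAIN: `exists_unitary_generator_elliptic_hyperbolic` — an INTEGRAL `g ∈ U(J)(F⁺)` with `det g = 1`, `c`-fixed trace,
  `|ι₁ tr g| < 2` (elliptic at `ι₁`) and `|σ tr g| > 2` (hyperbolic at `σ`): `g = x + y X₀` at one Pell solution with `y ≠ 0`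
  (`(ι x)² = 1 + ιβ (ιy)²` is `< 1` at `ι₁` and `> 1` at `σ`).  This is the letter `SigGEN` of the L5 closer skeleton
  (LA5-plan (g0) DEAL v2, 2026-09-02); composed with ★ `infinite_setOf_mem_principalCongruenceSubgroup_norm_le_of_generator`
  (LA5-p02) it yields `infinite_setOf_mem_principalCongruenceSubgroup_norm_le`: INFINITELY many `ι₁`-bounded elements in every
  `Γ_J(n)`, `n ≠ 0` — contradicting ★ `RecordSystemGS.finite_setOf_mem_norm_le_of_le_arithmeticLevel` for a record system of a
  fake-signature form.
HC_CM is proved only modulo the printed citations until rung 0 closes; this file discharges no named fact.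

## References
* [Neukirch1999] J. Neukirch, *Algebraic Number Theory*, Grundlehren 322, Springer 1999: Ch. I §7, Thm. (7.4) p. 42
  (Dirichlet's unit theorem) — the only non-elementary input, through Mathlib.
* [Borel1969] A. Borel, *Introduction aux groupes arithmétiques*, Hermann 1969, §1 and Prop. 7.13 (arithmetic subgroups are
  discrete in the FULL group of real points — the contrast).
* C. Maclachlan, A. Reid, *The Arithmetic of Hyperbolic 3-Manifolds*, GTM 219, §8.1–8.2; S. Katok, *Fuchsian Groups*, Ch. 5
  (arithmetic Fuchsian groups from quaternion algebras ramified at all other real places) — context only.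
* Tree: ★ `UnitaryGroupArithmeticLevels` (`principalCongruenceSubgroup`, `IsCongruentOneMod`, `unitaryGroup`), ★
  `UnitaryGroupEllipticGeneratorBounded` (the tail), ★ `UnitaryShimuraCurveRecordDiscrete` (the record side).
-/

set_option autoImplicit false

noncomputable section

open NumberField Matrix Polynomial
open scoped Matrix ComplexConjugate

namespace Literature.NumberTheory.Automorphic

namespace UnitaryGroup

namespace TwoIndefinitePlaces

open Literature.AlgebraicGeometry.ShimuraVarieties

/-! ### §1 The norm-one torus `x + y·X₀` of a `J`-skew square root `X₀` of `β` lies in `U(J)` -/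

section Torus

variable {E : Type*} [Field E] (σ : E →+* E) (J X₀ : Matrix (Fin 2) (Fin 2) E) (β x y : E)

/-- **The torus identity**: if `X₀` is `J`-skew (`(X₀^σ)ᵀ J = −J X₀`) with `X₀² = β`, and `x, y` are `σ`-fixed, then
`Y := x + y X₀` satisfies `(Y^σ)ᵀ J Y = (x² − β y²) J` — the norm form of the quadratic algebra `E^σ[X₀]` read on the
hermitian form. [folklore] -/
private theorem conjTranspose_torus_mul (hX : (X₀.map σ)ᵀ * J = -(J * X₀)) (hX2 : X₀ * X₀ = β • (1 : Matrix (Fin 2) (Fin 2) E))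
    (hx : σ x = x) (hy : σ y = y) :
    ((x • (1 : Matrix (Fin 2) (Fin 2) E) + y • X₀).map σ)ᵀ * J * (x • (1 : Matrix (Fin 2) (Fin 2) E) + y • X₀) =
      (x * x - β * y * y) • J := by
  have hmap : (x • (1 : Matrix (Fin 2) (Fin 2) E) + y • X₀).map σ = x • (1 : Matrix (Fin 2) (Fin 2) E) + y • X₀.map σ := by
    ext i j
    by_cases hij : i = j
    · simp [hij, hx, hy]
    · simp [hij, hy]
  rw [hmap, transpose_add, transpose_smul, transpose_smul, transpose_one]
  have h1 : (X₀.map σ)ᵀ * J * X₀ = -(β • J) := by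
    rw [hX, neg_mul, Matrix.mul_assoc, hX2, Matrix.mul_smul, Matrix.mul_one]
  have e : (x • (1 : Matrix (Fin 2) (Fin 2) E) + y • (X₀.map σ)ᵀ) * J * (x • (1 : Matrix (Fin 2) (Fin 2) E) + y • X₀) =
      (x * x) • J + (x * y) • (J * X₀) + (y * x) • ((X₀.map σ)ᵀ * J) + (y * y) • ((X₀.map σ)ᵀ * J * X₀) := by
    ext i j
    simp only [Matrix.mul_apply, Matrix.add_apply, Matrix.smul_apply, Matrix.one_apply, Fin.sum_univ_two, smul_eq_mul,
      Fin.isValue, mul_ite, mul_one, mul_zero]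
    fin_cases i <;> fin_cases j <;> simp <;> ring
  rw [e, h1, hX]
  ext i j
  simp only [Matrix.add_apply, Matrix.smul_apply, Matrix.neg_apply, smul_eq_mul]
  ring

/-- `(x + y X₀)(x − y X₀) = x² − β y²` (so for norm one the second factor is the inverse). [folklore] -/
private theorem torus_mul_torus_neg (hX2 : X₀ * X₀ = β • (1 : Matrix (Fin 2) (Fin 2) E)) :
    (x • (1 : Matrix (Fin 2) (Fin 2) E) + y • X₀) * (x • (1 : Matrix (Fin 2) (Fin 2) E) + (-y) • X₀) =
      (x * x - β * y * y) • (1 : Matrix (Fin 2) (Fin 2) E) := by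
  have e : (x • (1 : Matrix (Fin 2) (Fin 2) E) + y • X₀) * (x • (1 : Matrix (Fin 2) (Fin 2) E) + (-y) • X₀) =
      (x * x) • (1 : Matrix (Fin 2) (Fin 2) E) + (-(y * y)) • (X₀ * X₀) := by
    ext i j
    simp only [Matrix.mul_apply, Matrix.add_apply, Matrix.smul_apply, Matrix.one_apply, Fin.sum_univ_two, smul_eq_mul,
      Fin.isValue, mul_ite, mul_one, mul_zero]
    fin_cases i <;> fin_cases j <;> simp <;> ring
  rw [e, hX2]
  ext i j
  simp only [Matrix.add_apply, Matrix.smul_apply, smul_eq_mul]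
  ring

/-- `(x − y X₀)(x + y X₀) = x² − β y²`. [folklore] -/
private theorem torus_neg_mul_torus (hX2 : X₀ * X₀ = β • (1 : Matrix (Fin 2) (Fin 2) E)) :
    (x • (1 : Matrix (Fin 2) (Fin 2) E) + (-y) • X₀) * (x • (1 : Matrix (Fin 2) (Fin 2) E) + y • X₀) =
      (x * x - β * y * y) • (1 : Matrix (Fin 2) (Fin 2) E) := by
  have h := torus_mul_torus_neg X₀ β x (-y) hX2
  rw [neg_neg] at h
  rw [h]
  ring_nf

/-- **Distinct parameters give distinct torus elements** when `X₀` is not a scalar matrix. [folklore] -/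
private theorem torus_injective (hX : ∀ z : E, X₀ ≠ z • (1 : Matrix (Fin 2) (Fin 2) E)) {x y x' y' : E}
    (h : x • (1 : Matrix (Fin 2) (Fin 2) E) + y • X₀ = x' • (1 : Matrix (Fin 2) (Fin 2) E) + y' • X₀) :
    x = x' ∧ y = y' := by
  have hsub : (y - y') • X₀ = (x' - x) • (1 : Matrix (Fin 2) (Fin 2) E) := by
    have h0 : (x • (1 : Matrix (Fin 2) (Fin 2) E) + y • X₀) - (x' • (1 : Matrix (Fin 2) (Fin 2) E) + y' • X₀) = 0 :=
      sub_eq_zero.mpr h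
    rw [← sub_eq_zero]
    rw [← h0]
    ext i j
    simp only [Matrix.sub_apply, Matrix.add_apply, Matrix.smul_apply, smul_eq_mul]
    ring
  have hyy : y = y' := by
    by_contra hne
    have hne' : y - y' ≠ 0 := sub_ne_zero.mpr hne
    apply hX ((y - y')⁻¹ * (x' - x))
    rw [← smul_smul, ← hsub, smul_smul, inv_mul_cancel₀ hne', one_smul]
  refine ⟨?_, hyy⟩
  rw [hyy, sub_self, zero_smul] at hsub
  have h00 := congrFun (congrFun hsub 0) 0
  simp only [Matrix.zero_apply, Matrix.smul_apply, Matrix.one_apply_eq, smul_eq_mul, mul_one] at h00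
  exact (sub_eq_zero.mp h00.symm).symm

end Torus

/-! ### §2 Integral torus elements congruent to `1 mod n` -/

section Congruence

variable {E : Type*} [Field E]

/-- If `X₀` is integral, `x ≡ 1` and `y ≡ 0 (mod n)` integrally, then `x + y X₀ ≡ 1 (mod n)` integrally
(witness `s + t X₀`). [folklore] -/
private theorem isCongruentOneMod_torus (X₀ : Matrix (Fin 2) (Fin 2) E) (A : Matrix (Fin 2) (Fin 2) (𝓞 E))
    (hA : X₀ = A.map (algebraMap (𝓞 E) E)) (n : ℕ) (s t : 𝓞 E) {x y : E}
    (hx : x = 1 + n * algebraMap (𝓞 E) E s) (hy : y = n * algebraMap (𝓞 E) E t) :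
    IsCongruentOneMod n (x • (1 : Matrix (Fin 2) (Fin 2) E) + y • X₀) := by
  refine ⟨s • (1 : Matrix (Fin 2) (Fin 2) (𝓞 E)) + t • A, ?_⟩
  rw [hA, hx, hy]
  ext i j
  simp only [Matrix.add_apply, Matrix.smul_apply, Matrix.map_apply, smul_eq_mul, map_add, map_mul]
  rw [nsmul_eq_mul]
  by_cases hij : i = j
  · subst hij
    simp only [Matrix.one_apply_eq, map_one, mul_one]
    ring
  · simp only [Matrix.one_apply_ne hij, map_zero, mul_zero, zero_add]
    ring

end Congruence

/-! ### §3 Norm-one torus elements are bounded at a place where `β < 0` -/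

section Bound

variable {E : Type*} [Field E] (ι : E →+* ℂ)

/-- A complex number with zero imaginary part has norm `|re|`. [folklore] -/
private theorem norm_eq_abs_re_of_im {z : ℂ} (hz : z.im = 0) : ‖z‖ = |z.re| := by
  have h : z = (z.re : ℂ) := Complex.ext rfl (by simp [hz])
  rw [h, Complex.norm_real, Real.norm_eq_abs, Complex.ofReal_re]

/-- **Boundedness**: if `x² − β y² = 1` with `x, y, β` real under `ι` and `ι(β) < 0`, then `|ι x| ≤ 1`,
`|ι y| ≤ 1/√(−ι β)` and every entry of `ι(x + y X₀)` has norm `≤ 1 + ‖ι X₀ᵢⱼ‖ / √(−ι β)` — the torus is COMPACT at `ι`.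
[folklore] -/
private theorem norm_torus_apply_le (X₀ : Matrix (Fin 2) (Fin 2) E) {β x y : E} (hβ : (ι β).re < 0) (hβi : (ι β).im = 0)
    (hxi : (ι x).im = 0) (hyi : (ι y).im = 0) (h1 : x * x - β * y * y = 1) (i j : Fin 2) :
    ‖ι ((x • (1 : Matrix (Fin 2) (Fin 2) E) + y • X₀) i j)‖ ≤ 1 + ‖ι (X₀ i j)‖ / Real.sqrt (-(ι β).re) := by
  -- the real identity `a² + B b² = 1`
  set a : ℝ := (ι x).re with ha
  set b : ℝ := (ι y).re with hb
  set B : ℝ := -(ι β).re with hB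
  have hBpos : 0 < B := by rw [hB]; linarith
  have hre : a * a + B * (b * b) = 1 := by
    have h := congrArg (fun z : E => (ι z).re) h1
    simp only [map_sub, map_mul, map_one, Complex.sub_re, Complex.mul_re, Complex.one_re, hxi, hyi, hβi,
      mul_zero, sub_zero, Complex.mul_im, zero_mul, add_zero] at h
    rw [ha, hb, hB]
    linarith
  have ha1 : |a| ≤ 1 := by
    refine (sq_le_one_iff_abs_le_one a).mp ?_
    nlinarith [sq_nonneg b]
  have hb1 : |b| ≤ 1 / Real.sqrt B := by
    rw [one_div, ← Real.sqrt_inv]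
    refine Real.abs_le_sqrt ?_
    rw [inv_eq_one_div, le_div_iff₀ hBpos]
    nlinarith [sq_nonneg a]
  -- the entry
  have hx' : ‖ι x‖ ≤ 1 := by rw [norm_eq_abs_re_of_im hxi]; exact ha1
  have hy' : ‖ι y‖ ≤ 1 / Real.sqrt B := by rw [norm_eq_abs_re_of_im hyi]; exact hb1
  have hone : ‖ι ((1 : Matrix (Fin 2) (Fin 2) E) i j)‖ ≤ 1 := by
    by_cases hij : i = j
    · subst hij; simp
    · simp [hij]
  calc ‖ι ((x • (1 : Matrix (Fin 2) (Fin 2) E) + y • X₀) i j)‖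
      = ‖ι x * ι ((1 : Matrix (Fin 2) (Fin 2) E) i j) + ι y * ι (X₀ i j)‖ := by
        simp only [Matrix.add_apply, Matrix.smul_apply, smul_eq_mul, map_add, map_mul]
    _ ≤ ‖ι x‖ * ‖ι ((1 : Matrix (Fin 2) (Fin 2) E) i j)‖ + ‖ι y‖ * ‖ι (X₀ i j)‖ := by
        refine (norm_add_le _ _).trans ?_
        rw [norm_mul, norm_mul]
    _ ≤ 1 * 1 + (1 / Real.sqrt B) * ‖ι (X₀ i j)‖ := by
        gcongr
    _ = 1 + ‖ι (X₀ i j)‖ / Real.sqrt (-(ι β).re) := by rw [hB]; ring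
end Bound


/-! ### §4 Pell's equation with congruences over a number field (Dirichlet's unit theorem in `k(√β)`) -/

section Pell

variable {k : Type} [Field k]

/-- `X² − β` is irreducible over a number field `k` as soon as `β` is negative at some real embedding. [folklore] -/
private theorem irreducible_X_sq_sub_C {β : k} (ρ : k →+* ℝ) (hβ : ρ β < 0) : Irreducible (X ^ 2 - C β : k[X]) := by
  have hmonic : (X ^ 2 - C β : k[X]).Monic := monic_X_pow_sub_C β two_ne_zero
  have hdeg : (X ^ 2 - C β : k[X]).natDegree = 2 := natDegree_X_pow_sub_C
  refine (hmonic.irreducible_iff_roots_eq_zero_of_degree_le_three (by omega) (by omega)).mpr ?_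
  refine Multiset.eq_zero_of_forall_notMem fun r hr => ?_
  rw [mem_roots hmonic.ne_zero, IsRoot, eval_sub, eval_pow, eval_X, eval_C, sub_eq_zero] at hr
  have h := congrArg ρ hr
  rw [map_pow] at h
  nlinarith [sq_nonneg (ρ r)]

variable [NumberField k]

/-- **Pell's equation with congruences over a number field.**  Let `β` be an algebraic integer of the number field `k`,
negative at one real embedding `ρ₁` and positive at another `ρ₂`.  Then for every `n` there is an injective sequence of
solutions `(x, y) ∈ k × k` of `x² − β y² = 1` with `x ≡ 1` and `y ≡ 0 (mod n)` integrally.  Proof: `K = k(√β)` has a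
real place `w₂` over `ρ₂`; Dirichlet's unit `ε` at `w₂` (Mathlib `exists_unit`) gives the relative-norm-one unit `u = ε / ε̄`
of infinite order (`|u|_{w₂} > 1`); the coordinates of its powers have denominators dividing `2β` (traces), so two powers
agree modulo `n (2β)²` (pigeonhole in the finite ring `𝓞_k / n(2β)²`), their quotient `v` has coordinates `≡ (1, 0) mod n`,
and the powers of `v` are the sequence. [cite: Neukirch1999, Ch. I §7 Thm. (7.4) p. 42 (Dirichlet's unit theorem, for `k(√β)`)] -/
theorem exists_pell_seq (β : k) (hβint : IsIntegral ℤ β) (ρ₁ ρ₂ : k →+* ℝ) (h₁ : ρ₁ β < 0) (h₂ : 0 < ρ₂ β)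
    {n : ℕ} (hn : n ≠ 0) :
    ∃ f : ℕ → k × k, Function.Injective f ∧ ∀ m, (f m).1 * (f m).1 - β * (f m).2 * (f m).2 = 1 ∧
      (∃ s : k, IsIntegral ℤ s ∧ (f m).1 = 1 + n * s) ∧ (∃ t : k, IsIntegral ℤ t ∧ (f m).2 = n * t) := by
  classical
  -- §a the polynomial `P = X² − β` and the quadratic field `K = k[X]/(P)`
  obtain ⟨P, hP⟩ : ∃ P : k[X], P = X ^ 2 - C β := ⟨_, rfl⟩
  have hPev : ∀ (S : Type) [CommRing S] (i : k →+* S) (x : S), P.eval₂ i x = x * x - i β := by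
    intro S _ i x
    rw [hP, eval₂_sub, eval₂_X_pow, eval₂_C, pow_two]
  have hPi : Irreducible P := by rw [hP]; exact irreducible_X_sq_sub_C ρ₁ h₁
  haveI : Fact (Irreducible P) := ⟨hPi⟩
  have hP0 : P ≠ 0 := hPi.ne_zero
  have hmonic : P.Monic := by rw [hP]; exact monic_X_pow_sub_C β two_ne_zero
  have hPdeg : P.natDegree = 2 := by rw [hP]; exact natDegree_X_pow_sub_C
  haveI hcz : CharZero (AdjoinRoot P) :=
    charZero_of_injective_algebraMap (algebraMap k (AdjoinRoot P)).injective
  letI : Algebra ℚ (AdjoinRoot P) := DivisionRing.toRatAlgebra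
  haveI : IsScalarTower ℚ k (AdjoinRoot P) :=
    IsScalarTower.of_algebraMap_eq fun q => (map_ratCast (algebraMap k (AdjoinRoot P)) q).symm
  haveI : Module.Finite k (AdjoinRoot P) := (AdjoinRoot.powerBasis hP0).finite
  haveI : FiniteDimensional ℚ (AdjoinRoot P) := Module.Finite.trans k (AdjoinRoot P)
  haveI : NumberField (AdjoinRoot P) := NumberField.mk
  haveI : IsScalarTower ℤ k (AdjoinRoot P) :=
    IsScalarTower.of_algebraMap_eq fun z => (map_intCast (algebraMap k (AdjoinRoot P)) z).symm
  have hinj : Function.Injective (algebraMap k (AdjoinRoot P)) := (algebraMap k (AdjoinRoot P)).injective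
  obtain ⟨θ, hθ⟩ : ∃ θ : AdjoinRoot P, θ = AdjoinRoot.root P := ⟨_, rfl⟩
  have hθ2 : θ * θ = algebraMap k (AdjoinRoot P) β := by
    have h := AdjoinRoot.eval₂_root P
    rw [hPev, sub_eq_zero] at h
    rw [hθ, AdjoinRoot.algebraMap_eq]
    exact h
  have hβK : IsIntegral ℤ (algebraMap k (AdjoinRoot P) β) := map_isIntegral_int _ hβint
  have hθint : IsIntegral ℤ θ := IsIntegral.of_pow two_pos (by rw [pow_two, hθ2]; exact hβK)
  -- the coordinates `Ψ a b = a + b θ`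
  obtain ⟨Ψ, hΨ⟩ : ∃ Ψ : k → k → AdjoinRoot P,
      ∀ a b, Ψ a b = algebraMap k (AdjoinRoot P) a + algebraMap k (AdjoinRoot P) b * θ := ⟨_, fun _ _ => rfl⟩
  have hΨmul : ∀ a b a' b', Ψ a b * Ψ a' b' = Ψ (a * a' + β * b * b') (a * b' + b * a') := by
    intro a b a' b'
    simp only [hΨ, map_add, map_mul]
    linear_combination (algebraMap k (AdjoinRoot P) b * algebraMap k (AdjoinRoot P) b') * hθ2
  have hΨnorm : ∀ a b, Ψ a b * Ψ a (-b) = algebraMap k (AdjoinRoot P) (a * a - β * b * b) := by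
    intro a b
    simp only [hΨ, map_mul, map_sub, map_neg]
    linear_combination (-(algebraMap k (AdjoinRoot P) b * algebraMap k (AdjoinRoot P) b)) * hθ2
  have hΨone : Ψ 1 0 = 1 := by rw [hΨ, map_one, map_zero, zero_mul, add_zero]
  have hΨcoord : ∀ z : AdjoinRoot P, ∃ a b : k, z = Ψ a b := by
    intro z
    obtain ⟨q, rfl⟩ := AdjoinRoot.mk_surjective z
    obtain ⟨r, hr⟩ : ∃ r : k[X], r = q %ₘ P := ⟨_, rfl⟩
    have hdeg : r.natDegree ≤ 1 := by
      have h : r.natDegree < P.natDegree := by rw [hr]; exact natDegree_modByMonic_lt q hmonic hPi.ne_one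
      omega
    have hqr : AdjoinRoot.mk P q = AdjoinRoot.mk P r := by
      rw [AdjoinRoot.mk_eq_mk]
      refine ⟨q /ₘ P, ?_⟩
      have := modByMonic_add_div q P
      rw [hr]
      linear_combination (-1 : k[X]) * this
    refine ⟨r.coeff 0, r.coeff 1, ?_⟩
    rw [hqr]
    conv_lhs => rw [eq_X_add_C_of_natDegree_le_one hdeg]
    rw [map_add, map_mul, AdjoinRoot.mk_C, AdjoinRoot.mk_C, AdjoinRoot.mk_X, hΨ, hθ, AdjoinRoot.algebraMap_eq]
    ring
  -- §b the conjugation `gal : θ ↦ −θ`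
  have hgal0 : P.eval₂ (↑(Algebra.ofId k (AdjoinRoot P)) : k →+* AdjoinRoot P) (-θ) = 0 := by
    rw [hPev, neg_mul_neg, hθ2]
    simp
  obtain ⟨gal, hgalθ, hgalc⟩ : ∃ g : AdjoinRoot P →ₐ[k] AdjoinRoot P, g θ = -θ ∧
      ∀ a, g (algebraMap k (AdjoinRoot P) a) = algebraMap k (AdjoinRoot P) a := by
    refine ⟨AdjoinRoot.liftAlgHom P (Algebra.ofId k (AdjoinRoot P)) (-θ) hgal0, ?_, fun a => AlgHom.commutes _ a⟩
    have h := AdjoinRoot.liftAlgHom_root P (Algebra.ofId k (AdjoinRoot P)) (-θ) hgal0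
    rw [← hθ] at h
    exact h
  have hΨgal : ∀ a b, gal (Ψ a b) = Ψ a (-b) := by
    intro a b
    simp only [hΨ, map_add, map_mul, hgalc, hgalθ, map_neg]
    ring
  have hgalgal : ∀ z, gal (gal z) = z := by
    intro z
    obtain ⟨a, b, rfl⟩ := hΨcoord z
    rw [hΨgal, hΨgal, neg_neg]
  have hgal_int : ∀ z : AdjoinRoot P, IsIntegral ℤ z → IsIntegral ℤ (gal z) := fun z hz => map_isIntegral_int gal hz
  -- §c the two real embeddings over `ρ₂` and their (distinct) places
  have hsq : Real.sqrt (ρ₂ β) * Real.sqrt (ρ₂ β) = ρ₂ β := Real.mul_self_sqrt h₂.le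
  have hsqpos : 0 < Real.sqrt (ρ₂ β) := Real.sqrt_pos.mpr h₂
  have hev : P.eval₂ ρ₂ (Real.sqrt (ρ₂ β)) = 0 := by rw [hPev, hsq, sub_self]
  have hev' : P.eval₂ ρ₂ (-Real.sqrt (ρ₂ β)) = 0 := by rw [hPev, neg_mul_neg, hsq, sub_self]
  obtain ⟨φ₂, hφ₂θ, hφ₂a⟩ : ∃ φ : AdjoinRoot P →+* ℂ, φ θ = (Real.sqrt (ρ₂ β) : ℂ) ∧
      ∀ a : k, φ (algebraMap k (AdjoinRoot P) a) = (ρ₂ a : ℂ) :=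
    ⟨Complex.ofRealHom.comp (AdjoinRoot.lift ρ₂ (Real.sqrt (ρ₂ β)) hev),
      by rw [RingHom.comp_apply, hθ, AdjoinRoot.lift_root]; rfl,
      fun a => by rw [RingHom.comp_apply, AdjoinRoot.algebraMap_eq, AdjoinRoot.lift_of]; rfl⟩
  obtain ⟨φ₂', hφ₂'θ, hφ₂'a⟩ : ∃ φ : AdjoinRoot P →+* ℂ, φ θ = -(Real.sqrt (ρ₂ β) : ℂ) ∧
      ∀ a : k, φ (algebraMap k (AdjoinRoot P) a) = (ρ₂ a : ℂ) :=
    ⟨Complex.ofRealHom.comp (AdjoinRoot.lift ρ₂ (-Real.sqrt (ρ₂ β)) hev'),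
      by rw [RingHom.comp_apply, hθ, AdjoinRoot.lift_root]; simp,
      fun a => by rw [RingHom.comp_apply, AdjoinRoot.algebraMap_eq, AdjoinRoot.lift_of]; rfl⟩
  have hφΨ : ∀ a b, φ₂ (Ψ a b) = (ρ₂ a : ℂ) + (ρ₂ b : ℂ) * (Real.sqrt (ρ₂ β) : ℂ) := by
    intro a b; simp only [hΨ, map_add, map_mul, hφ₂θ, hφ₂a]
  have hφ'Ψ : ∀ a b, φ₂' (Ψ a b) = (ρ₂ a : ℂ) - (ρ₂ b : ℂ) * (Real.sqrt (ρ₂ β) : ℂ) := by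
    intro a b
    simp only [hΨ, map_add, map_mul, hφ₂'θ, hφ₂'a]
    ring
  have hφgal : ∀ z, φ₂ (gal z) = φ₂' z := by
    intro z
    obtain ⟨a, b, rfl⟩ := hΨcoord z
    rw [hΨgal, hφΨ, hφ'Ψ, map_neg, Complex.ofReal_neg]
    ring
  obtain ⟨w₂, hw₂⟩ : ∃ w : InfinitePlace (AdjoinRoot P), w = InfinitePlace.mk φ₂ := ⟨_, rfl⟩
  obtain ⟨w₂', hw₂'⟩ : ∃ w : InfinitePlace (AdjoinRoot P), w = InfinitePlace.mk φ₂' := ⟨_, rfl⟩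
  have hww : w₂' ≠ w₂ := by
    intro h
    rw [hw₂', hw₂, InfinitePlace.mk_eq_iff] at h
    rcases h with h | h
    · have h' := congrArg (fun ψ : AdjoinRoot P →+* ℂ => (ψ θ).re) h
      simp only [hφ₂θ, hφ₂'θ, Complex.neg_re, Complex.ofReal_re] at h'
      linarith
    · have h' := congrArg (fun ψ : AdjoinRoot P →+* ℂ => (ψ θ).re) h
      simp only [ComplexEmbedding.conjugate_coe_eq, hφ₂θ, hφ₂'θ, Complex.neg_re, Complex.ofReal_re,
        Complex.conj_re] at h'
      linarith
  have hwgal : ∀ z, w₂ (gal z) = w₂' z := by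
    intro z
    rw [hw₂, hw₂', InfinitePlace.apply, InfinitePlace.apply, hφgal]
  have hw₂Ψ : ∀ a b : k, w₂ (Ψ a b) = |ρ₂ a + ρ₂ b * Real.sqrt (ρ₂ β)| := by
    intro a b
    rw [hw₂, InfinitePlace.apply, hφΨ]
    norm_cast
  -- §d Dirichlet's unit at `w₂` and the norm-one unit `u = ε / gal ε`
  obtain ⟨ε, hε⟩ := NumberField.Units.dirichletUnitTheorem.exists_unit (AdjoinRoot P) w₂
  obtain ⟨εK, hεK⟩ : ∃ x : AdjoinRoot P, x = algebraMap (𝓞 (AdjoinRoot P)) (AdjoinRoot P) (ε : 𝓞 (AdjoinRoot P)) :=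
    ⟨_, rfl⟩
  have hεpos : ∀ w : InfinitePlace (AdjoinRoot P), 0 < w εK := fun w => by
    rw [hεK]; exact NumberField.Units.pos_at_place ε w
  have hε0 : εK ≠ 0 := InfinitePlace.pos_iff.mp (hεpos w₂)
  have hεint : IsIntegral ℤ εK := by rw [hεK]; exact RingOfIntegers.isIntegral_coe _
  have hεinv_int : IsIntegral ℤ εK⁻¹ := by
    have h : εK⁻¹ = algebraMap (𝓞 (AdjoinRoot P)) (AdjoinRoot P) ((ε⁻¹ : (𝓞 (AdjoinRoot P))ˣ) : 𝓞 (AdjoinRoot P)) := by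
      refine (eq_inv_of_mul_eq_one_right ?_).symm
      rw [hεK, ← map_mul, ← Units.val_mul, mul_inv_cancel, Units.val_one, map_one]
    rw [h]
    exact RingOfIntegers.isIntegral_coe _
  have hlt : w₂' εK < 1 := by
    have h := hε w₂' hww
    rw [← hεK] at h
    rwa [Real.log_neg_iff (hεpos w₂')] at h
  have hgt : 1 < w₂ εK := by
    have hsum := NumberField.Units.sum_mult_mul_log ε
    rw [← Finset.add_sum_erase _ _ (Finset.mem_univ w₂)] at hsum
    have hneg : ∑ w ∈ Finset.univ.erase w₂,
        ((w.mult : ℝ) * Real.log (w (algebraMap (𝓞 (AdjoinRoot P)) (AdjoinRoot P) ε))) < 0 := by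
      refine Finset.sum_neg (fun w hw => ?_) ⟨w₂', Finset.mem_erase.mpr ⟨hww, Finset.mem_univ _⟩⟩
      exact mul_neg_of_pos_of_neg (Nat.cast_pos.mpr InfinitePlace.mult_pos) (hε w (Finset.ne_of_mem_erase hw))
    have hpos : 0 < (w₂.mult : ℝ) * Real.log (w₂ εK) := by rw [hεK]; linarith
    have hlog : 0 < Real.log (w₂ εK) :=
      (pos_iff_pos_of_mul_pos hpos).mp (Nat.cast_pos.mpr InfinitePlace.mult_pos)
    exact (Real.log_pos_iff (hεpos w₂).le).mp hlog
  have hgalε0 : gal εK ≠ 0 := (map_ne_zero_iff _ gal.toRingHom.injective).mpr hε0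
  obtain ⟨u, hu⟩ : ∃ x : AdjoinRoot P, x = εK * (gal εK)⁻¹ := ⟨_, rfl⟩
  have hu_norm : u * gal u = 1 := by
    rw [hu, map_mul, map_inv₀, hgalgal]
    field_simp
  have hu_int : IsIntegral ℤ u := by
    rw [hu, ← map_inv₀]
    exact hεint.mul (hgal_int _ hεinv_int)
  have hu1 : 1 < w₂ u := by
    rw [hu, map_mul, map_inv₀, hwgal]
    rw [lt_mul_inv_iff₀ (hεpos w₂'), one_mul]
    exact hlt.trans hgt
  have hupos : 0 < w₂ u := lt_trans one_pos hu1
  have hu0 : u ≠ 0 := InfinitePlace.pos_iff.mp hupos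
  -- §e coordinates of the powers of `u`: norm one and denominators dividing `2β`
  have hcoordpow : ∀ m : ℕ, ∃ a b : k, u ^ m = Ψ a b ∧ a * a - β * b * b = 1 ∧
      IsIntegral ℤ (2 * β * a) ∧ IsIntegral ℤ (2 * β * b) := by
    intro m
    obtain ⟨a, b, hab⟩ := hΨcoord (u ^ m)
    have hum_int : IsIntegral ℤ (u ^ m) := hu_int.pow m
    have hnorm1 : (u ^ m) * gal (u ^ m) = 1 := by rw [map_pow, ← mul_pow, hu_norm, one_pow]
    refine ⟨a, b, hab, ?_, ?_, ?_⟩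
    · apply hinj
      rw [← hΨnorm, map_one, ← hΨgal, ← hab]
      exact hnorm1
    · have htr : u ^ m + gal (u ^ m) = algebraMap k (AdjoinRoot P) (2 * a) := by
        rw [hab, hΨgal]
        simp only [hΨ, map_mul, map_neg, map_ofNat]
        ring
      have h2a : IsIntegral ℤ (2 * a) := by
        refine (isIntegral_algebraMap_iff hinj).mp ?_
        rw [← htr]
        exact hum_int.add (hgal_int _ hum_int)
      have : 2 * β * a = β * (2 * a) := by ring
      rw [this]
      exact hβint.mul h2a
    · have htr : θ * u ^ m + gal (θ * u ^ m) = algebraMap k (AdjoinRoot P) (2 * β * b) := by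
        rw [map_mul, hgalθ, hab, hΨgal]
        simp only [hΨ, map_mul, map_neg, map_ofNat]
        linear_combination (2 * algebraMap k (AdjoinRoot P) b) * hθ2
      refine (isIntegral_algebraMap_iff hinj).mp ?_
      rw [← htr]
      exact (hθint.mul hum_int).add (hgal_int _ (hθint.mul hum_int))
  choose a b hab hnorm hainteg hbinteg using hcoordpow
  have habinj : Function.Injective fun m => (a m, b m) := by
    intro m m' h
    simp only [Prod.mk.injEq] at h
    have hpow : u ^ m = u ^ m' := by rw [hab m, hab m', h.1, h.2]
    have := congrArg w₂ hpow
    rw [map_pow, map_pow] at this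
    exact (pow_right_strictMono₀ hu1).injective this
  -- §f pigeonhole modulo `n D²`, `D = 2β`
  obtain ⟨D, hD⟩ : ∃ D : k, D = 2 * β := ⟨_, rfl⟩
  have hβ0 : β ≠ 0 := by rintro rfl; simp at h₂
  have hD0 : D ≠ 0 := by rw [hD]; exact mul_ne_zero two_ne_zero hβ0
  have h2int : IsIntegral ℤ (2 : k) := by simpa using isIntegral_natCast (B := k) 2
  have hDint : IsIntegral ℤ D := by rw [hD]; exact h2int.mul hβint
  have hDa : ∀ m, IsIntegral ℤ (D * a m) := fun m => by rw [hD]; exact hainteg m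
  have hDb : ∀ m, IsIntegral ℤ (D * b m) := fun m => by rw [hD]; exact hbinteg m
  -- the modulus `N₀ := n D²` in `𝓞 k`
  obtain ⟨N₀, hN₀⟩ : ∃ x : 𝓞 k, (x : k) = n * D * D :=
    ⟨⟨n * D * D, (isIntegral_natCast (B := k) n).mul hDint |>.mul hDint⟩, rfl⟩
  have hN₀0 : N₀ ≠ 0 := by
    intro h
    have : (N₀ : k) = 0 := by rw [h]; rfl
    rw [hN₀] at this
    exact mul_ne_zero (mul_ne_zero (Nat.cast_ne_zero.mpr hn) hD0) hD0 this
  obtain ⟨I, hIdef⟩ : ∃ I : Ideal (𝓞 k), I = Ideal.span {N₀} := ⟨_, rfl⟩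
  have hI : I ≠ ⊥ := by rw [hIdef, Ne, Ideal.span_singleton_eq_bot]; exact hN₀0
  haveI : Finite (𝓞 k ⧸ I) := Ideal.finiteQuotientOfFreeOfNeBot I hI
  let g : ℕ → (𝓞 k ⧸ I) × (𝓞 k ⧸ I) := fun m =>
    (Ideal.Quotient.mk I ⟨D * a m, hDa m⟩, Ideal.Quotient.mk I ⟨D * b m, hDb m⟩)
  obtain ⟨m₁, m₂, hne, hg⟩ := Finite.exists_ne_map_eq_of_infinite g
  simp only [g, Prod.mk.injEq, Ideal.Quotient.eq, hIdef, Ideal.mem_span_singleton'] at hg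
  obtain ⟨⟨cs, hcs⟩, ⟨ct, hct⟩⟩ := hg
  have hcs' : a m₁ = a m₂ + n * (D * (cs : k)) := by
    have h := congrArg (algebraMap (𝓞 k) k) hcs
    rw [map_mul, map_sub, ← RingOfIntegers.coe_eq_algebraMap N₀, hN₀] at h
    change (cs : k) * (n * D * D) = D * a m₁ - D * a m₂ at h
    apply mul_left_cancel₀ hD0
    linear_combination -h
  have hct' : b m₁ = b m₂ + n * (D * (ct : k)) := by
    have h := congrArg (algebraMap (𝓞 k) k) hct
    rw [map_mul, map_sub, ← RingOfIntegers.coe_eq_algebraMap N₀, hN₀] at h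
    change (ct : k) * (n * D * D) = D * b m₁ - D * b m₂ at h
    apply mul_left_cancel₀ hD0
    linear_combination -h
  have hcsint : IsIntegral ℤ (cs : k) := RingOfIntegers.isIntegral_coe cs
  have hctint : IsIntegral ℤ (ct : k) := RingOfIntegers.isIntegral_coe ct
  have hnint : IsIntegral ℤ (n : k) := isIntegral_natCast (B := k) n
  -- §g the quotient `v = u^{m₁} / u^{m₂}`: norm one, `|v|_{w₂} ≠ 1`, coordinates `(A, B) ≡ (1, 0) mod n`
  obtain ⟨v, hv⟩ : ∃ x : AdjoinRoot P, x = u ^ m₁ * gal (u ^ m₂) := ⟨_, rfl⟩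
  have hgalpow : ∀ m : ℕ, u ^ m * gal (u ^ m) = 1 := fun m => by rw [map_pow, ← mul_pow, hu_norm, one_pow]
  have hv_norm : v * gal v = 1 := by
    rw [hv, map_mul, hgalgal]
    calc u ^ m₁ * gal (u ^ m₂) * (gal (u ^ m₁) * u ^ m₂)
        = (u ^ m₁ * gal (u ^ m₁)) * (u ^ m₂ * gal (u ^ m₂)) := by ring
      _ = 1 := by rw [hgalpow, hgalpow, mul_one]
  have hwv : w₂ v = w₂ u ^ m₁ * (w₂ u ^ m₂)⁻¹ := by
    have h2 : w₂ (gal (u ^ m₂)) = (w₂ u ^ m₂)⁻¹ := by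
      have h := congrArg w₂ (hgalpow m₂)
      rw [map_mul, map_one, map_pow] at h
      exact eq_inv_of_mul_eq_one_right h
    rw [hv, map_mul, map_pow, h2]
  have hvpos : 0 < w₂ v := by rw [hwv]; positivity
  have hv1 : w₂ v ≠ 1 := by
    intro h
    rw [hwv, mul_inv_eq_one₀ (pow_ne_zero _ hupos.ne')] at h
    exact hne ((pow_right_strictMono₀ hu1).injective h)
  have hvinj : Function.Injective fun j : ℕ => w₂ v ^ j := by
    rcases lt_or_gt_of_ne hv1 with h | h
    · exact (pow_right_strictAnti₀ hvpos h).injective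
    · exact (pow_right_strictMono₀ h).injective
  obtain ⟨A, hA⟩ : ∃ x : k, x = a m₁ * a m₂ + β * b m₁ * (-b m₂) := ⟨_, rfl⟩
  obtain ⟨B, hB⟩ : ∃ x : k, x = a m₁ * (-b m₂) + b m₁ * a m₂ := ⟨_, rfl⟩
  have hvAB : v = Ψ A B := by rw [hv, hab m₁, hab m₂, hΨgal, hΨmul, hA, hB]
  obtain ⟨S₀, hS₀⟩ : ∃ x : k, x = (cs : k) * (D * a m₂) - β * (ct : k) * (D * b m₂) := ⟨_, rfl⟩
  obtain ⟨T₀, hT₀⟩ : ∃ x : k, x = (ct : k) * (D * a m₂) - (cs : k) * (D * b m₂) := ⟨_, rfl⟩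
  have hS₀int : IsIntegral ℤ S₀ := by
    rw [hS₀]; exact (hcsint.mul (hDa m₂)).sub ((hβint.mul hctint).mul (hDb m₂))
  have hT₀int : IsIntegral ℤ T₀ := by
    rw [hT₀]; exact (hctint.mul (hDa m₂)).sub (hcsint.mul (hDb m₂))
  have hAS : A = 1 + n * S₀ := by
    rw [hA, hS₀, hcs', hct']
    linear_combination hnorm m₂
  have hBT : B = n * T₀ := by
    rw [hB, hT₀, hcs', hct']
    ring
  -- §h the powers of `v` in coordinates: the sequence
  let step : k × k → k × k := fun q => (q.1 * A + β * q.2 * B, q.1 * B + q.2 * A)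
  let seq : ℕ → k × k := fun j => step^[j] (1, 0)
  have hseq0 : seq 0 = (1, 0) := rfl
  have hseqS : ∀ j, seq (j + 1) = step (seq j) := fun j => Function.iterate_succ_apply' step j (1, 0)
  have hΨseq : ∀ j, Ψ (seq j).1 (seq j).2 = v ^ j := by
    intro j
    induction j with
    | zero => rw [hseq0, pow_zero]; exact hΨone
    | succ j ih => rw [hseqS, pow_succ, ← ih, hvAB, hΨmul]
  have hseq_norm : ∀ j, (seq j).1 * (seq j).1 - β * (seq j).2 * (seq j).2 = 1 := by
    intro j
    apply hinj
    rw [← hΨnorm, map_one, ← hΨgal, hΨseq, map_pow, ← mul_pow, hv_norm, one_pow]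
  have hseq_cong : ∀ j, (∃ s : k, IsIntegral ℤ s ∧ (seq j).1 = 1 + n * s) ∧
      (∃ t : k, IsIntegral ℤ t ∧ (seq j).2 = n * t) := by
    intro j
    induction j with
    | zero => exact ⟨⟨0, isIntegral_zero, by rw [hseq0]; ring⟩, ⟨0, isIntegral_zero, by rw [hseq0]; ring⟩⟩
    | succ j ih =>
      obtain ⟨⟨s, hs, e1⟩, ⟨t, ht, e2⟩⟩ := ih
      refine ⟨⟨s + S₀ + n * s * S₀ + β * n * t * T₀, ?_, ?_⟩, ⟨T₀ + n * s * T₀ + t + n * t * S₀, ?_, ?_⟩⟩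
      · exact ((hs.add hS₀int).add ((hnint.mul hs).mul hS₀int)).add (((hβint.mul hnint).mul ht).mul hT₀int)
      · rw [hseqS]
        change (seq j).1 * A + β * (seq j).2 * B = _
        rw [e1, e2, hAS, hBT]
        ring
      · exact ((hT₀int.add ((hnint.mul hs).mul hT₀int)).add ht).add ((hnint.mul ht).mul hS₀int)
      · rw [hseqS]
        change (seq j).1 * B + (seq j).2 * A = _
        rw [e1, e2, hAS, hBT]
        ring
  refine ⟨seq, fun j j' hjj => ?_, fun j => ⟨hseq_norm j, hseq_cong j⟩⟩
  have h := congrArg (fun q : k × k => w₂ (Ψ q.1 q.2)) hjj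
  simp only [hΨseq, map_pow] at h
  exact hvinj h

end Pell

/-! ### §5 The frame: diagonalising a hermitian plane and planting a `J`-skew square root with prescribed signs -/

section Frame

variable {E : Type*} [Field E]

/-- **Small at one real embedding, large at another.**  If two ring homomorphisms `ρ₁, ρ₂ : k → ℝ` differ, then for
all `c₁ > 0` and `c₂` some `y ∈ k` has `|ρ₁ y| < c₁` and `c₂ < |ρ₂ y|` (take `y = N (z − q)` with `ρ₁ z ≠ ρ₂ z`, `q ∈ ℚ`
close to `ρ₁ z`, `N` large). [folklore] -/
private theorem exists_abs_lt_lt_abs {k : Type*} [Field k] (ρ₁ ρ₂ : k →+* ℝ) (z : k) (hz : ρ₁ z ≠ ρ₂ z) (c₁ c₂ : ℝ)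
    (hc₁ : 0 < c₁) : ∃ y : k, |ρ₁ y| < c₁ ∧ c₂ < |ρ₂ y| := by
  set d : ℝ := |ρ₁ z - ρ₂ z| with hd
  have hdpos : 0 < d := abs_pos.mpr (sub_ne_zero.mpr hz)
  obtain ⟨N, hN⟩ := exists_nat_gt ((|c₂| + 1) / (d / 2))
  have hNpos : (0 : ℝ) < N := lt_trans (by positivity) hN
  have hNd : |c₂| + 1 < N * (d / 2) := by rwa [div_lt_iff₀ (by positivity)] at hN
  set ε : ℝ := min (d / 2) (c₁ / (N + 1)) with hε
  have hεpos : 0 < ε := lt_min (by positivity) (by positivity)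
  obtain ⟨q, hq1, hq2⟩ := exists_rat_btwn (show ρ₁ z - ε < ρ₁ z by linarith)
  refine ⟨(N : k) * (z - (q : k)), ?_, ?_⟩
  · rw [map_mul, map_natCast, map_sub, map_ratCast, abs_mul, Nat.abs_cast]
    have h1 : |ρ₁ z - (q : ℝ)| < ε := by rw [abs_lt]; constructor <;> linarith
    have h2 : ε ≤ c₁ / (N + 1) := min_le_right _ _
    calc (N : ℝ) * |ρ₁ z - (q : ℝ)| ≤ N * ε := by gcongr
      _ ≤ N * (c₁ / (N + 1)) := by gcongr
      _ < c₁ := by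
          rw [mul_div_assoc', div_lt_iff₀ (by positivity)]
          nlinarith
  · rw [map_mul, map_natCast, map_sub, map_ratCast, abs_mul, Nat.abs_cast]
    have h1 : |ρ₁ z - (q : ℝ)| < d / 2 := by
      have : |ρ₁ z - (q : ℝ)| < ε := by rw [abs_lt]; constructor <;> linarith
      exact this.trans_le (min_le_left _ _)
    have h2 : d / 2 < |ρ₂ z - (q : ℝ)| := by
      have h3 : d ≤ |ρ₁ z - (q : ℝ)| + |ρ₂ z - (q : ℝ)| := by
        rw [hd]
        calc |ρ₁ z - ρ₂ z| = |(ρ₁ z - (q : ℝ)) - (ρ₂ z - (q : ℝ))| := by ring_nf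
          _ ≤ |ρ₁ z - (q : ℝ)| + |ρ₂ z - (q : ℝ)| := abs_sub _ _
      linarith
    calc c₂ ≤ |c₂| := le_abs_self _
      _ < N * (d / 2) := by linarith
      _ ≤ N * |ρ₂ z - (q : ℝ)| := by gcongr

/-- **Diagonal frame of a hermitian plane**: for `J ∈ M₂(E)` hermitian for the involution `σ` (`(J^σ)ᵀ = J`) with
`det J ≠ 0` (and `2 ≠ 0`), there is an invertible `P` with `(P^σ)ᵀ J P` diagonal (Gram–Schmidt on an anisotropic vector:
`e₀` if `J₀₀ ≠ 0`, `e₁` if `J₁₁ ≠ 0`, else `e₀ + J₀₁⁻¹ e₁`). [folklore] -/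
private theorem exists_diag_frame (h2 : (2 : E) ≠ 0) (σ : E →+* E) (J : Matrix (Fin 2) (Fin 2) E)
    (hJ : (J.map σ)ᵀ = J) (hJ0 : J.det ≠ 0) :
    ∃ (Pm Pi : Matrix (Fin 2) (Fin 2) E) (p r : E), Pm * Pi = 1 ∧ Pi * Pm = 1 ∧
      (Pm.map σ)ᵀ * J * Pm = !![p, 0; 0, r] := by
  have h00 : σ (J 0 0) = J 0 0 := by simpa using congrFun (congrFun hJ 0) 0
  have h11 : σ (J 1 1) = J 1 1 := by simpa using congrFun (congrFun hJ 1) 1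
  have h01 : σ (J 1 0) = J 0 1 := by simpa using congrFun (congrFun hJ 0) 1
  have h10 : σ (J 0 1) = J 1 0 := by simpa using congrFun (congrFun hJ 1) 0
  by_cases hA : J 0 0 ≠ 0
  · have hdet : (!![1, J 0 1; 0, -J 0 0] : Matrix (Fin 2) (Fin 2) E).det ≠ 0 := by
      rw [Matrix.det_fin_two_of]; simpa using hA
    refine ⟨!![1, J 0 1; 0, -J 0 0], (!![1, J 0 1; 0, -J 0 0])⁻¹, J 0 0, J 0 0 * J.det,
      Matrix.mul_nonsing_inv _ (Ne.isUnit hdet), Matrix.nonsing_inv_mul _ (Ne.isUnit hdet), ?_⟩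
    ext i j
    rw [Matrix.det_fin_two]
    fin_cases i <;> fin_cases j <;>
      simp [Matrix.mul_apply, Fin.sum_univ_two, h00, h10] <;> ring
  · push Not at hA
    by_cases hB : J 1 1 ≠ 0
    · have hdet : (!![0, J 1 1; 1, -J 1 0] : Matrix (Fin 2) (Fin 2) E).det ≠ 0 := by
        rw [Matrix.det_fin_two_of]; simpa using hB
      refine ⟨!![0, J 1 1; 1, -J 1 0], (!![0, J 1 1; 1, -J 1 0])⁻¹, J 1 1, J 1 1 * J.det,
        Matrix.mul_nonsing_inv _ (Ne.isUnit hdet), Matrix.nonsing_inv_mul _ (Ne.isUnit hdet), ?_⟩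
      ext i j
      rw [Matrix.det_fin_two]
      fin_cases i <;> fin_cases j <;>
        simp [Matrix.mul_apply, Fin.sum_univ_two, h11, h01, hA] <;> ring
    · push Not at hB
      have hb : J 0 1 ≠ 0 := by
        intro h
        apply hJ0
        rw [Matrix.det_fin_two, hA, hB, h]
        ring
      have hb' : J 1 0 ≠ 0 := by
        intro h
        apply hb
        rw [← h01, h, map_zero]
      have hdet : (!![1, J 0 1; (J 0 1)⁻¹, -1] : Matrix (Fin 2) (Fin 2) E).det ≠ 0 := by
        rw [Matrix.det_fin_two_of]
        simp only [mul_inv_cancel₀ hb]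
        intro h
        apply h2
        linear_combination -h
      refine ⟨!![1, J 0 1; (J 0 1)⁻¹, -1], (!![1, J 0 1; (J 0 1)⁻¹, -1])⁻¹, 2, -(2 * (J 1 0 * J 0 1)),
        Matrix.mul_nonsing_inv _ (Ne.isUnit hdet), Matrix.nonsing_inv_mul _ (Ne.isUnit hdet), ?_⟩
      ext i j
      fin_cases i <;> fin_cases j <;>
        simp [Matrix.mul_apply, Fin.sum_univ_two, h10, hA, hB, map_inv₀, mul_inv_cancel₀ hb,
          inv_mul_cancel₀ hb'] <;> field_simp <;> ring

/-- **The `J`-skew element in a diagonal frame**: for `D = diag(p, r)` with `p, r` fixed by `σ`, `δ` with `σ δ = −δ` and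
`y` fixed by `σ`, the traceless matrix `M = (δ, −(r/p) y; y, −δ)` is `D`-skew (`(M^σ)ᵀ D = −D M`) and `M² = (δ² − (r/p) y²)·1`.
[folklore] -/
private theorem skew_diag {σ : E →+* E} {p r δ y : E} (hp : σ p = p) (hr : σ r = r) (hδ : σ δ = -δ) (hy : σ y = y)
    (hp0 : p ≠ 0) :
    ((!![δ, -(r / p) * y; y, -δ] : Matrix (Fin 2) (Fin 2) E).map σ)ᵀ * !![p, 0; 0, r] =
        -(!![p, 0; 0, r] * !![δ, -(r / p) * y; y, -δ]) ∧
      (!![δ, -(r / p) * y; y, -δ] : Matrix (Fin 2) (Fin 2) E) * !![δ, -(r / p) * y; y, -δ] =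
        (δ * δ - r / p * y * y) • (1 : Matrix (Fin 2) (Fin 2) E) := by
  constructor
  · ext i j
    fin_cases i <;> fin_cases j <;>
      simp [Matrix.mul_apply, Fin.sum_univ_two, hp, hr, hδ, hy, map_neg, map_mul, map_div₀] <;> field_simp
  · ext i j
    fin_cases i <;> fin_cases j <;> simp [Matrix.mul_apply, Fin.sum_univ_two] <;> ring

/-- **Transport of skewness along a frame**: if `(Pm^σ)ᵀ J Pm = D`, `Pm Pi = Pi Pm = 1` and `M` is `D`-skew, then
`X := Pm M Pi` is `J`-skew, `X² = Pm M² Pi`, and `X` is scalar only if `M` is. [folklore] -/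
private theorem skew_conj (σ : E →+* E) {J D M Pm Pi : Matrix (Fin 2) (Fin 2) E} (hPi : Pm * Pi = 1) (hPi' : Pi * Pm = 1)
    (hD : (Pm.map σ)ᵀ * J * Pm = D) (hM : (M.map σ)ᵀ * D = -(D * M)) :
    ((Pm * M * Pi).map σ)ᵀ * J = -(J * (Pm * M * Pi)) := by
  have hA : (Pm.map σ)ᵀ * (Pi.map σ)ᵀ = 1 := by
    rw [← Matrix.transpose_mul, ← Matrix.map_mul, hPi', Matrix.map_one σ (map_zero σ) (map_one σ),
      Matrix.transpose_one]
  have hA' : (Pi.map σ)ᵀ * (Pm.map σ)ᵀ = 1 := by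
    rw [← Matrix.transpose_mul, ← Matrix.map_mul, hPi, Matrix.map_one σ (map_zero σ) (map_one σ),
      Matrix.transpose_one]
  have hJ' : J = (Pi.map σ)ᵀ * (D * Pi) := by
    rw [← hD]
    calc J = ((Pi.map σ)ᵀ * (Pm.map σ)ᵀ) * J * (Pm * Pi) := by rw [hA', hPi, Matrix.one_mul, Matrix.mul_one]
      _ = (Pi.map σ)ᵀ * ((Pm.map σ)ᵀ * J * Pm * Pi) := by simp only [Matrix.mul_assoc]
  have hcancel : ∀ X : Matrix (Fin 2) (Fin 2) E, (Pm.map σ)ᵀ * ((Pi.map σ)ᵀ * X) = X := fun X => by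
    rw [← Matrix.mul_assoc, hA, Matrix.one_mul]
  have hcancel' : ∀ X : Matrix (Fin 2) (Fin 2) E, Pi * (Pm * X) = X := fun X => by
    rw [← Matrix.mul_assoc, hPi', Matrix.one_mul]
  rw [hJ', Matrix.map_mul, Matrix.map_mul, Matrix.transpose_mul, Matrix.transpose_mul]
  simp only [Matrix.mul_assoc, hcancel, hcancel']
  rw [← Matrix.mul_assoc ((M.map σ)ᵀ) D Pi, hM]
  simp only [Matrix.neg_mul, Matrix.mul_neg, Matrix.mul_assoc]

/-- `(Pm M Pi)² = Pm M² Pi` when `Pi Pm = 1`. [folklore] -/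
private theorem conj_mul_conj {M Pm Pi : Matrix (Fin 2) (Fin 2) E} (hPi' : Pi * Pm = 1) :
    (Pm * M * Pi) * (Pm * M * Pi) = Pm * (M * M) * Pi := by
  calc (Pm * M * Pi) * (Pm * M * Pi) = Pm * M * (Pi * Pm) * M * Pi := by simp only [Matrix.mul_assoc]
    _ = Pm * (M * M) * Pi := by rw [hPi', Matrix.mul_one]; simp only [Matrix.mul_assoc]

/-- A conjugate of a non-scalar matrix is non-scalar. [folklore] -/
private theorem conj_ne_scalar {M Pm Pi : Matrix (Fin 2) (Fin 2) E} (hPi' : Pi * Pm = 1)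
    (hM : ∀ z : E, M ≠ z • (1 : Matrix (Fin 2) (Fin 2) E)) (z : E) :
    Pm * M * Pi ≠ z • (1 : Matrix (Fin 2) (Fin 2) E) := by
  intro h
  apply hM z
  calc M = Pi * (Pm * M * Pi) * Pm := by
        rw [show Pi * (Pm * M * Pi) * Pm = (Pi * Pm) * M * (Pi * Pm) by simp only [Matrix.mul_assoc], hPi',
          Matrix.one_mul, Matrix.mul_one]
    _ = z • (1 : Matrix (Fin 2) (Fin 2) E) := by rw [h, Matrix.mul_smul, Matrix.mul_one, Matrix.smul_mul, hPi']

end Frame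

/-! ### §6 The generator: an integral element of `U(J)` of determinant one, elliptic at `ι₁` and hyperbolic at `σ` -/

section Generator

variable (F : Type) [Field F] [NumberField F] [IsCMField F]

/-- **Distinct complex places of a CM field restrict to distinct real embeddings of its maximal real subfield**
(`InfinitePlace F ≃ InfinitePlace F⁺`, Mathlib `IsCMField.equivInfinitePlace`). [folklore] -/
private theorem exists_restrict_ne_of_mk_ne (ι₁ σ : F →+* ℂ) (hne : InfinitePlace.mk σ ≠ InfinitePlace.mk ι₁) :
    ∃ z : ↥(maximalRealSubfield F), σ (z : F) ≠ ι₁ (z : F) := by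
  by_contra h
  push Not at h
  apply hne
  apply (IsCMField.equivInfinitePlace F).injective
  rw [IsCMField.equivInfinitePlace_apply, IsCMField.equivInfinitePlace_apply, InfinitePlace.comap_mk,
    InfinitePlace.comap_mk]
  congr 1
  exact RingHom.ext fun z => h z

/-- **The generator.**  Let `J ∈ M₂(F)` be hermitian for the CM involution `c`, INDEFINITE (`det < 0`) at the complex
embedding `ι₁` AND at a second embedding `σ` defining a different place.  Then `U(J)(F⁺)` contains an INTEGRAL element `g`
of determinant `1` with `c`-fixed trace which is ELLIPTIC at `ι₁` (`|ι₁ tr g| < 2`) and HYPERBOLIC at `σ` (`|σ tr g| > 2`):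
`g = x + y X₀` for a `J`-skew integral square root `X₀` of a `c`-fixed `β` with `ι₁ β < 0 < σ β` (diagonal frame + a
parameter small at `ι₁|F⁺` and large at `σ|F⁺`) and a solution `y ≠ 0` of Pell's equation `x² − β y² = 1` in `𝓞_{F⁺}`
(Dirichlet's unit theorem in `F⁺(√β)`).  This is the «two non-compact places» input showing that a congruence subgroup of
such a `U(J)` is NOT discrete at `ι₁`.
[cite: Neukirch1999, Ch. I §7 Thm. (7.4) p. 42 (Dirichlet's unit theorem, the only non-elementary input)]
[cite: Borel1969, §1 and Prop. 7.13 (arithmetic groups are discrete in the full real group; here two non-compact factors)] -/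
theorem exists_unitary_generator_elliptic_hyperbolic (ι₁ σ : F →+* ℂ) (J : Matrix (Fin 2) (Fin 2) F)
    (hJ : (J.map (IsCMField.complexConj F))ᵀ = J) (h₁ : (J.map ι₁).det.re < 0) (h₂ : (J.map σ).det.re < 0)
    (hne : InfinitePlace.mk σ ≠ InfinitePlace.mk ι₁) :
    ∃ (g : GL (Fin 2) F) (G : Matrix (Fin 2) (Fin 2) (𝓞 F)),
      g ∈ unitaryGroup ((IsCMField.complexConj F : F ≃ₐ[↥(maximalRealSubfield F)] F) : F →+* F) J ∧
      G.map (algebraMap (𝓞 F) F) = (g : Matrix (Fin 2) (Fin 2) F) ∧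
      (g : Matrix (Fin 2) (Fin 2) F).det = 1 ∧
      IsCMField.complexConj F (g : Matrix (Fin 2) (Fin 2) F).trace = (g : Matrix (Fin 2) (Fin 2) F).trace ∧
      ‖ι₁ (g : Matrix (Fin 2) (Fin 2) F).trace‖ < 2 ∧ 2 < ‖σ (g : Matrix (Fin 2) (Fin 2) F).trace‖ := by
  classical
  -- §0 the involution and the two embeddings
  set c : F →+* F := ((IsCMField.complexConj F : F ≃ₐ[↥(maximalRealSubfield F)] F) : F →+* F) with hc
  have hcapp : ∀ x, c x = IsCMField.complexConj F x := fun x => rfl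
  have hcc : ∀ x, c (c x) = x := fun x => IsCMField.complexConj_apply_apply F x
  have hιc : ∀ (ι : F →+* ℂ) (x : F), ι (c x) = conj (ι x) := fun ι x => IsCMField.complexEmbedding_complexConj F ι x
  have him : ∀ (ι : F →+* ℂ) (x : F), c x = x → (ι x).im = 0 := fun ι x hx => by
    have h := hιc ι x
    rw [hx] at h
    exact Complex.conj_eq_iff_im.mp h.symm
  have hk : ∀ z : ↥(maximalRealSubfield F), c (z : F) = z := fun z => IsCMField.complexConj_apply_eq_self F z
  have hJ' : (J.map c)ᵀ = J := hJ
  -- §1 a `c`-anti-fixed `δ ≠ 0`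
  obtain ⟨δ, hδ, hδ0⟩ : ∃ δ : F, c δ = -δ ∧ δ ≠ 0 := by
    obtain ⟨x, hx⟩ : ∃ x : F, IsCMField.complexConj F x ≠ x := by
      by_contra h
      push Not at h
      exact IsCMField.complexConj_ne_one F (AlgEquiv.ext h)
    refine ⟨x - c x, by rw [map_sub, hcc]; ring, sub_ne_zero.mpr (Ne.symm hx)⟩
  have hδre : ∀ ι : F →+* ℂ, (ι (δ * δ)).re < 0 ∧ (ι (δ * δ)).im = 0 := by
    intro ι
    have hre : (ι δ).re = 0 := by
      have h := hιc ι δ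
      rw [hδ, map_neg] at h
      have := congrArg Complex.re h
      simp only [Complex.neg_re, Complex.conj_re] at this
      linarith
    have hne0 : (ι δ).im ≠ 0 := by
      intro h0
      apply hδ0
      have : ι δ = 0 := Complex.ext hre h0
      exact (map_eq_zero ι).mp this
    refine ⟨?_, ?_⟩
    · rw [map_mul, Complex.mul_re, hre, zero_mul, zero_sub, neg_lt_zero]
      exact mul_self_pos.mpr hne0
    · rw [map_mul, Complex.mul_im, hre, zero_mul, mul_zero, add_zero]
  -- §2 the diagonal frame
  have hdetc : c J.det = J.det := by
    conv_rhs => rw [← hJ', Matrix.det_transpose]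
    exact RingHom.map_det c J
  have hdetι : ∀ ι : F →+* ℂ, (J.map ι).det = ι J.det := fun ι => (RingHom.map_det ι J).symm
  have hJ0 : J.det ≠ 0 := by
    intro h
    have := h₁
    rw [hdetι, h, map_zero, Complex.zero_re] at this
    exact lt_irrefl _ this
  obtain ⟨Pm, Pi, p, r, hPmPi, hPiPm, hD⟩ := exists_diag_frame two_ne_zero c J hJ' hJ0
  -- `p r = N(det Pm) · det J`, `p`, `r` are `c`-fixed and nonzero, `ι(r/p) < 0` at every indefinite `ι`
  have hpr : p * r = c Pm.det * Pm.det * J.det := by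
    have h := congrArg Matrix.det hD
    rw [Matrix.det_mul, Matrix.det_mul, Matrix.det_transpose, ← RingHom.mapMatrix_apply, ← RingHom.map_det,
      Matrix.det_fin_two_of] at h
    linear_combination -h
  have hPm0 : Pm.det ≠ 0 := by
    intro h
    have := congrArg Matrix.det hPmPi
    rw [Matrix.det_mul, h, zero_mul, Matrix.det_one] at this
    exact zero_ne_one this
  have hDherm : ((!![p, 0; 0, r] : Matrix (Fin 2) (Fin 2) F).map c)ᵀ = !![p, 0; 0, r] := by
    rw [← hD]
    have hcc' : (⇑c ∘ ⇑c : F → F) = id := funext hcc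
    simp only [Matrix.map_mul, Matrix.transpose_mul, Matrix.transpose_map, Matrix.map_map, hcc', Matrix.map_id,
      Matrix.transpose_transpose, hJ', Matrix.mul_assoc]
  have hp : c p = p := by simpa using congrFun (congrFun hDherm 0) 0
  have hr : c r = r := by simpa using congrFun (congrFun hDherm 1) 1
  have hp0 : p ≠ 0 := by
    intro h
    have : p * r = 0 := by rw [h, zero_mul]
    rw [hpr] at this
    exact mul_ne_zero (mul_ne_zero ((_root_.map_ne_zero c).mpr hPm0) hPm0) hJ0 this
  have hrp : c (r / p) = r / p := by rw [map_div₀, hr, hp]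
  have hrpι : ∀ ι : F →+* ℂ, (ι J.det).re < 0 → (ι (r / p)).re < 0 ∧ (ι (r / p)).im = 0 := by
    intro ι hι
    have hpim : (ι p).im = 0 := him ι p hp
    have hpre : (ι p).re ≠ 0 := by
      intro h
      exact hp0 ((map_eq_zero ι).mp (Complex.ext h hpim))
    have hdetim : (ι J.det).im = 0 := him ι _ hdetc
    -- `ι (p r) = |ι det Pm|² ι(det J)`
    have hprι : ι (p * r) = (Complex.normSq (ι Pm.det) : ℂ) * ι J.det := by
      rw [hpr, map_mul, map_mul, hιc, Complex.normSq_eq_conj_mul_self]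
    have hnpos : 0 < Complex.normSq (ι Pm.det) := Complex.normSq_pos.mpr ((_root_.map_ne_zero ι).mpr hPm0)
    have hprre : (ι (p * r)).re < 0 := by
      rw [hprι, Complex.re_ofReal_mul]
      exact mul_neg_of_pos_of_neg hnpos hι
    -- `r/p = (p r)/p²`
    have hrp_eq : ι (r / p) = ι (p * r) / (ι p * ι p) := by
      rw [map_div₀, map_mul]
      field_simp
    have hpp : ι p * ι p = ((ι p).re * (ι p).re : ℝ) := by
      rw [Complex.ext_iff]
      simp [Complex.mul_re, Complex.mul_im, hpim]
    have hpp_pos : 0 < (ι p).re * (ι p).re := mul_self_pos.mpr hpre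
    rw [hrp_eq, hpp]
    constructor
    · rw [Complex.div_ofReal_re]
      exact div_neg_of_neg_of_pos hprre hpp_pos
    · rw [Complex.div_ofReal_im, him ι _ (by rw [map_mul, hp, hr])]
      simp
  obtain ⟨ha₁, ha₁i⟩ := hrpι ι₁ (by rwa [← hdetι])
  obtain ⟨ha₂, ha₂i⟩ := hrpι σ (by rwa [← hdetι])
  -- §3 the parameter `y ∈ F⁺`: small at `ι₁`, large at `σ`
  set k : Type := ↥(maximalRealSubfield F) with hkdef
  have hρ : ∀ ι : F →+* ℂ, ComplexEmbedding.IsReal (ι.comp (algebraMap k F)) := fun ι =>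
    IsTotallyReal.complexEmbedding_isReal _
  set ρ₁ : k →+* ℝ := (hρ ι₁).embedding with hρ₁
  set ρ₂ : k →+* ℝ := (hρ σ).embedding with hρ₂
  have hρ₁c : ∀ z : k, (ρ₁ z : ℂ) = ι₁ (z : F) := fun z => ComplexEmbedding.IsReal.coe_embedding_apply (hρ ι₁) z
  have hρ₂c : ∀ z : k, (ρ₂ z : ℂ) = σ (z : F) := fun z => ComplexEmbedding.IsReal.coe_embedding_apply (hρ σ) z
  have hρ₁re : ∀ z : k, ρ₁ z = (ι₁ (z : F)).re := fun z => by rw [← hρ₁c, Complex.ofReal_re]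
  have hρ₂re : ∀ z : k, ρ₂ z = (σ (z : F)).re := fun z => by rw [← hρ₂c, Complex.ofReal_re]
  obtain ⟨z, hz⟩ := exists_restrict_ne_of_mk_ne F ι₁ σ hne
  have hz' : ρ₁ z ≠ ρ₂ z := by
    intro h
    apply hz
    rw [← hρ₁c, ← hρ₂c, h]
  -- constants: `dᵢ := −ι(δ²) > 0`, `aᵢ := −ι(r/p) > 0`
  obtain ⟨hd₁, hd₁i⟩ := hδre ι₁
  obtain ⟨hd₂, hd₂i⟩ := hδre σ
  set d₁ : ℝ := -(ι₁ (δ * δ)).re with hd₁def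
  set d₂ : ℝ := -(σ (δ * δ)).re with hd₂def
  set a₁ : ℝ := -(ι₁ (r / p)).re with ha₁def
  set a₂ : ℝ := -(σ (r / p)).re with ha₂def
  have hd₁pos : 0 < d₁ := by rw [hd₁def]; linarith
  have hd₂pos : 0 < d₂ := by rw [hd₂def]; linarith
  have ha₁pos : 0 < a₁ := by rw [ha₁def]; linarith
  have ha₂pos : 0 < a₂ := by rw [ha₂def]; linarith
  obtain ⟨yk, hy₁, hy₂⟩ := exists_abs_lt_lt_abs ρ₁ ρ₂ z hz' (min 1 (d₁ / a₁)) (max 1 (d₂ / a₂))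
    (lt_min one_pos (div_pos hd₁pos ha₁pos))
  set y : F := (yk : F) with hydef
  have hy : c y = y := hk yk
  have hy0 : y ≠ 0 := by
    intro h
    have : ρ₂ yk = 0 := by rw [hρ₂re, ← hydef, h, map_zero, Complex.zero_re]
    rw [this, abs_zero] at hy₂
    linarith [le_max_left (1 : ℝ) (d₂ / a₂)]
  -- §4 `β := δ² − (r/p) y²`: `c`-fixed, `ι₁ β < 0 < σ β`
  set β : F := δ * δ - r / p * y * y with hβdef
  have hβc : c β = β := by rw [hβdef, map_sub, map_mul, map_mul, map_mul, hδ, hrp, hy]; ring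
  have hβι : ∀ ι : F →+* ℂ, (ι β).re = (ι (δ * δ)).re - (ι (r / p)).re * ((ι y).re * (ι y).re) ∧ (ι β).im = 0 := by
    intro ι
    have hyi : (ι y).im = 0 := him ι y hy
    have hrpi : (ι (r / p)).im = 0 := him ι _ hrp
    have hddi : (ι (δ * δ)).im = 0 := (hδre ι).2
    have e : ι β = (((ι (δ * δ)).re - (ι (r / p)).re * ((ι y).re * (ι y).re) : ℝ) : ℂ) := by
      rw [hβdef, map_sub, map_mul ι (r / p * y) y, map_mul ι (r / p) y]
      refine Complex.ext ?_ ?_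
      · simp only [Complex.sub_re, Complex.mul_re, Complex.mul_im, Complex.ofReal_re, hyi, hrpi, mul_zero, sub_zero,
          zero_mul, add_zero]
        ring
      · simp only [Complex.sub_im, Complex.mul_re, Complex.mul_im, Complex.ofReal_im, hyi, hrpi, hddi, mul_zero,
          sub_zero, zero_mul, add_zero, sub_self]
    rw [e]
    exact ⟨Complex.ofReal_re _, Complex.ofReal_im _⟩
  have hβ₁ : (ι₁ β).re < 0 := by
    rw [(hβι ι₁).1, ← hρ₁re]
    have h1 : |ρ₁ yk| < 1 := lt_of_lt_of_le hy₁ (min_le_left _ _)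
    have h2 : |ρ₁ yk| < d₁ / a₁ := lt_of_lt_of_le hy₁ (min_le_right _ _)
    have h3 : ρ₁ yk * ρ₁ yk < d₁ / a₁ := by
      have h4 : |ρ₁ yk| * |ρ₁ yk| < 1 * (d₁ / a₁) :=
        mul_lt_mul'' h1 h2 (abs_nonneg _) (abs_nonneg _)
      rw [one_mul, abs_mul_abs_self] at h4
      exact h4
    have h5 : a₁ * (ρ₁ yk * ρ₁ yk) < d₁ := by rwa [← lt_div_iff₀' ha₁pos]
    change (ι₁ (δ * δ)).re - (ι₁ (r / p)).re * (ρ₁ yk * ρ₁ yk) < 0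
    linarith
  have hβ₂ : 0 < (σ β).re := by
    rw [(hβι σ).1, ← hρ₂re]
    have h1 : 1 < |ρ₂ yk| := lt_of_le_of_lt (le_max_left _ _) hy₂
    have h2 : d₂ / a₂ < |ρ₂ yk| := lt_of_le_of_lt (le_max_right _ _) hy₂
    have h3 : d₂ / a₂ < ρ₂ yk * ρ₂ yk := by
      have h4 : 1 * (d₂ / a₂) < |ρ₂ yk| * |ρ₂ yk| :=
        mul_lt_mul'' h1 h2 zero_le_one (div_pos hd₂pos ha₂pos).le
      rw [one_mul, abs_mul_abs_self] at h4
      exact h4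
    have h5 : d₂ < a₂ * (ρ₂ yk * ρ₂ yk) := by rwa [← div_lt_iff₀' ha₂pos]
    change 0 < (σ (δ * δ)).re - (σ (r / p)).re * (ρ₂ yk * ρ₂ yk)
    linarith
  -- §5 the `J`-skew square root `X₁ = Pm M Pi` of `β`, then an INTEGRAL multiple `X₀` (square root of `β₀ = N₀² β`)
  obtain ⟨hMskew, hMsq⟩ := skew_diag (σ := c) hp hr hδ hy hp0
  set M : Matrix (Fin 2) (Fin 2) F := !![δ, -(r / p) * y; y, -δ] with hMdef
  have hX₁skew := skew_conj c hPmPi hPiPm hD hMskew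
  have hX₁sq : (Pm * M * Pi) * (Pm * M * Pi) = β • (1 : Matrix (Fin 2) (Fin 2) F) := by
    rw [conj_mul_conj hPiPm, hMsq, ← hβdef, Matrix.mul_smul, Matrix.mul_one, Matrix.smul_mul, hPmPi]
  have hMns : ∀ w : F, M ≠ w • (1 : Matrix (Fin 2) (Fin 2) F) := by
    intro w h
    have := congrFun (congrFun h 1) 0
    simp [hMdef] at this
    exact hy0 this
  have hX₁ns := conj_ne_scalar hPiPm hMns
  have hX₁tr : (Pm * M * Pi).trace = 0 := by
    rw [Matrix.trace_mul_cycle, hPiPm, Matrix.one_mul, hMdef, Matrix.trace_fin_two_of]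
    ring
  -- integral multiple
  haveI : Algebra.IsAlgebraic ℤ F := (IsFractionRing.comap_isAlgebraic_iff (A := ℤ) (K := ℚ) (C := F)).mpr
    inferInstance
  obtain ⟨N₀, hN₀0, hN₀⟩ := Algebra.IsAlgebraic.exists_integral_multiples ℤ
    (Finset.univ.image fun ij : Fin 2 × Fin 2 => (Pm * M * Pi) ij.1 ij.2)
  have hN₀int : ∀ i j, IsIntegral ℤ ((N₀ : F) * (Pm * M * Pi) i j) := fun i j => by
    have h := hN₀ ((Pm * M * Pi) i j) (Finset.mem_image.mpr ⟨(i, j), Finset.mem_univ _, rfl⟩)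
    rwa [zsmul_eq_mul] at h
  set X₀ : Matrix (Fin 2) (Fin 2) F := (N₀ : F) • (Pm * M * Pi) with hX₀def
  set β₀ : F := (N₀ : F) * (N₀ : F) * β with hβ₀def
  have hX₀skew : (X₀.map c)ᵀ * J = -(J * X₀) := by
    have hmap : X₀.map c = (N₀ : F) • (Pm * M * Pi).map c := by
      rw [hX₀def]
      ext i j
      simp only [Matrix.map_apply, Matrix.smul_apply, smul_eq_mul, map_mul, map_intCast]
    rw [hmap, Matrix.transpose_smul, Matrix.smul_mul, hX₁skew, hX₀def, Matrix.mul_smul, smul_neg]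
  have hX₀sq : X₀ * X₀ = β₀ • (1 : Matrix (Fin 2) (Fin 2) F) := by
    rw [hX₀def, Matrix.smul_mul, Matrix.mul_smul, hX₁sq, smul_smul, smul_smul, hβ₀def]
  have hX₀ns : ∀ w : F, X₀ ≠ w • (1 : Matrix (Fin 2) (Fin 2) F) := by
    intro w h
    apply hX₁ns ((N₀ : F)⁻¹ * w)
    have hN : (N₀ : F) ≠ 0 := Int.cast_ne_zero.mpr hN₀0
    rw [← smul_smul, ← h, hX₀def, smul_smul, inv_mul_cancel₀ hN, one_smul]
  have hX₀tr : X₀.trace = 0 := by rw [hX₀def, Matrix.trace_smul, hX₁tr, smul_zero]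
  obtain ⟨A, hA⟩ : ∃ A : Matrix (Fin 2) (Fin 2) (𝓞 F), X₀ = A.map (algebraMap (𝓞 F) F) :=
    ⟨Matrix.of fun i j => ⟨X₀ i j, by rw [hX₀def, Matrix.smul_apply, smul_eq_mul]; exact hN₀int i j⟩,
      by ext i j; rfl⟩
  have hβ₀c : c β₀ = β₀ := by rw [hβ₀def, map_mul, map_mul, map_intCast, hβc]
  have hN₀sq : (0 : ℝ) < (N₀ : ℝ) * (N₀ : ℝ) := mul_self_pos.mpr (Int.cast_ne_zero.mpr hN₀0)
  have hβ₀ι : ∀ ι : F →+* ℂ, (ι β₀).re = (N₀ : ℝ) * (N₀ : ℝ) * (ι β).re ∧ (ι β₀).im = 0 := by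
    intro ι
    rw [hβ₀def, map_mul, map_mul, map_intCast]
    obtain ⟨-, hi⟩ := hβι ι
    constructor
    · simp [Complex.mul_re, Complex.mul_im, hi]
    · simp [Complex.mul_re, Complex.mul_im, hi]
  have hβ₀₁ : (ι₁ β₀).re < 0 := by rw [(hβ₀ι ι₁).1]; exact mul_neg_of_pos_of_neg hN₀sq hβ₁
  have hβ₀₂ : 0 < (σ β₀).re := by rw [(hβ₀ι σ).1]; exact mul_pos hN₀sq hβ₂
  have hβ₀int : IsIntegral ℤ β₀ := by
    have h : β₀ = (X₀ * X₀) 0 0 := by rw [hX₀sq]; simp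
    rw [h, Matrix.mul_apply, Fin.sum_univ_two, hA]
    simp only [Matrix.map_apply]
    exact ((RingOfIntegers.isIntegral_coe _).mul (RingOfIntegers.isIntegral_coe _)).add
      ((RingOfIntegers.isIntegral_coe _).mul (RingOfIntegers.isIntegral_coe _))
  -- §6 Pell in `F⁺(√β₀)`: a solution `x² − β₀ y'² = 1` with `y' ≠ 0`
  have hβ₀k : β₀ ∈ maximalRealSubfield F := (IsCMField.complexConj_eq_self_iff F β₀).mp hβ₀c
  set βk : k := ⟨β₀, hβ₀k⟩ with hβkdef
  have hβkF : (βk : F) = β₀ := rfl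
  haveI : IsScalarTower ℤ k F := IsScalarTower.of_algebraMap_eq fun z => (map_intCast (algebraMap k F) z).symm
  have hβkint : IsIntegral ℤ βk :=
    (isIntegral_algebraMap_iff (algebraMap k F).injective).mp (by rw [show algebraMap k F βk = β₀ from rfl]; exact hβ₀int)
  have hρ₁β : ρ₁ βk < 0 := by rw [hρ₁re]; exact hβ₀₁
  have hρ₂β : 0 < ρ₂ βk := by rw [hρ₂re]; exact hβ₀₂
  obtain ⟨f, hfinj, hf⟩ := exists_pell_seq βk hβkint ρ₁ ρ₂ hρ₁β hρ₂β one_ne_zero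
  -- among three distinct solutions one has `y' ≠ 0` (only `(±1, 0)` have `y' = 0`)
  obtain ⟨m, hm⟩ : ∃ m : ℕ, (f m).2 ≠ 0 := by
    by_contra h
    push Not at h
    have hsq : ∀ m, (f m).1 = 1 ∨ (f m).1 = -1 := fun m => by
      have e := (hf m).1
      rw [h m, mul_zero, sub_zero] at e
      rcases mul_self_eq_one_iff.mp e with e' | e'
      · exact Or.inl e'
      · exact Or.inr e'
    have hfm : ∀ m, f m = (1, 0) ∨ f m = (-1, 0) := fun m => by
      rcases hsq m with e | e
      · left; exact Prod.ext e (h m)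
      · right; exact Prod.ext e (h m)
    -- three values into two boxes
    have key : ∀ m m', m ≠ m' → f m ≠ f m' := fun m m' hmm' hff => hmm' (hfinj hff)
    rcases hfm 0 with e0 | e0 <;> rcases hfm 1 with e1 | e1 <;> rcases hfm 2 with e2 | e2
    · exact key 0 1 (by norm_num) (e0.trans e1.symm)
    · exact key 0 1 (by norm_num) (e0.trans e1.symm)
    · exact key 0 2 (by norm_num) (e0.trans e2.symm)
    · exact key 1 2 (by norm_num) (e1.trans e2.symm)
    · exact key 1 2 (by norm_num) (e1.trans e2.symm)
    · exact key 0 2 (by norm_num) (e0.trans e2.symm)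
    · exact key 0 1 (by norm_num) (e0.trans e1.symm)
    · exact key 0 1 (by norm_num) (e0.trans e1.symm)
  set x : F := ((f m).1 : F) with hxdef
  set y' : F := ((f m).2 : F) with hy'def
  have hxc : c x = x := hk _
  have hy'c : c y' = y' := hk _
  have hy'0 : y' ≠ 0 := fun h => hm (Subtype.ext h)
  have hnorm : x * x - β₀ * y' * y' = 1 := by
    have e := congrArg (algebraMap k F) (hf m).1
    rw [map_sub, map_mul, map_mul, map_mul, map_one] at e
    exact e
  obtain ⟨s, hsint, hs⟩ := (hf m).2.1
  obtain ⟨t, htint, ht⟩ := (hf m).2.2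
  -- §7 the generator `g = x + y' X₀`
  set gm : Matrix (Fin 2) (Fin 2) F := x • (1 : Matrix (Fin 2) (Fin 2) F) + y' • X₀ with hgm
  set gi : Matrix (Fin 2) (Fin 2) F := x • (1 : Matrix (Fin 2) (Fin 2) F) + (-y') • X₀ with hgi
  have hgg : gm * gi = 1 := by rw [hgm, hgi, torus_mul_torus_neg X₀ β₀ x y' hX₀sq, hnorm, one_smul]
  have hgg' : gi * gm = 1 := by rw [hgm, hgi, torus_neg_mul_torus X₀ β₀ x y' hX₀sq, hnorm, one_smul]
  let g : GL (Fin 2) F := ⟨gm, gi, hgg, hgg'⟩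
  have hgcoe : (g : Matrix (Fin 2) (Fin 2) F) = gm := rfl
  -- integrality: `G := x + y' A` lifts `g`
  have hsF : IsIntegral ℤ (s : F) := map_isIntegral_int (algebraMap k F) hsint
  have htF : IsIntegral ℤ (t : F) := map_isIntegral_int (algebraMap k F) htint
  have hxint : IsIntegral ℤ x := by
    have e : x = 1 + (s : F) := by
      have e' := congrArg (algebraMap k F) hs
      rw [map_add, map_mul, map_one, map_natCast, Nat.cast_one, one_mul] at e'
      exact e'
    rw [e]
    exact isIntegral_one.add hsF
  have hy'int : IsIntegral ℤ y' := by
    have e : y' = (t : F) := by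
      have e' := congrArg (algebraMap k F) ht
      rw [map_mul, map_natCast, Nat.cast_one, one_mul] at e'
      exact e'
    rw [e]
    exact htF
  obtain ⟨xO, hxO⟩ : ∃ xO : 𝓞 F, algebraMap (𝓞 F) F xO = x := ⟨⟨x, hxint⟩, rfl⟩
  obtain ⟨yO, hyO⟩ : ∃ yO : 𝓞 F, algebraMap (𝓞 F) F yO = y' := ⟨⟨y', hy'int⟩, rfl⟩
  obtain ⟨G, hG⟩ : ∃ G : Matrix (Fin 2) (Fin 2) (𝓞 F), G.map (algebraMap (𝓞 F) F) = gm := by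
    refine ⟨xO • (1 : Matrix (Fin 2) (Fin 2) (𝓞 F)) + yO • A, ?_⟩
    rw [hgm, hA]
    ext i j
    by_cases hij : i = j
    · subst hij
      simp [hxO, hyO]
    · simp [hij, hyO]
  -- trace and determinant
  have htr : gm.trace = 2 * x := by
    rw [hgm, Matrix.trace_add, Matrix.trace_smul, Matrix.trace_smul, hX₀tr, Matrix.trace_one, Fintype.card_fin,
      smul_zero, add_zero, smul_eq_mul]
    push_cast
    ring
  have hdet : gm.det = 1 := by
    have htr0 : X₀ 0 0 + X₀ 1 1 = 0 := by rw [← Matrix.trace_fin_two]; exact hX₀tr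
    have hd : X₀ 0 0 * X₀ 1 1 - X₀ 0 1 * X₀ 1 0 = -β₀ := by
      have h := congrFun (congrFun hX₀sq 0) 0
      simp only [Matrix.mul_apply, Fin.sum_univ_two, Matrix.smul_apply, Matrix.one_apply_eq, smul_eq_mul,
        mul_one] at h
      linear_combination (X₀ 0 0) * htr0 - h
    rw [hgm, Matrix.det_fin_two]
    simp only [Matrix.add_apply, Matrix.smul_apply, Matrix.one_apply_eq, smul_eq_mul, mul_one,
      Matrix.one_apply_ne (show (0 : Fin 2) ≠ 1 by decide), Matrix.one_apply_ne (show (1 : Fin 2) ≠ 0 by decide),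
      mul_zero, zero_add]
    linear_combination hnorm + (y' * y') * hd + (x * y') * htr0
  -- sizes of the trace: `(ι x)² = 1 + ι β₀ (ι y')²`
  have hxι : ∀ ι : F →+* ℂ, (ι x).re * (ι x).re = 1 + (ι β₀).re * ((ι y').re * (ι y').re) ∧ (ι x).im = 0 ∧
      ((ι y').re ≠ 0) := by
    intro ι
    have hxi : (ι x).im = 0 := him ι x hxc
    have hyi : (ι y').im = 0 := him ι y' hy'c
    have hbi : (ι β₀).im = 0 := (hβ₀ι ι).2
    have e := congrArg (fun t : F => (ι t).re) hnorm
    simp only [map_sub, map_mul, map_one, Complex.sub_re, Complex.mul_re, Complex.mul_im, Complex.one_re, hxi, hyi, hbi,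
      mul_zero, sub_zero, zero_mul, add_zero] at e
    refine ⟨by linarith, hxi, fun h0 => hy'0 ((map_eq_zero ι).mp (Complex.ext h0 hyi))⟩
  have htrι : ∀ ι : F →+* ℂ, ‖ι gm.trace‖ = 2 * |(ι x).re| := by
    intro ι
    rw [htr, map_mul, map_ofNat, norm_mul, Complex.norm_ofNat, norm_eq_abs_re_of_im (hxι ι).2.1]
  refine ⟨g, G, ?_, ?_, hdet, ?_, ?_, ?_⟩
  · -- unitary
    rw [Literature.AlgebraicGeometry.ShimuraVarieties.mem_unitaryGroup_iff, hgcoe, hgm,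
      conjTranspose_torus_mul c J X₀ β₀ x y' hX₀skew hX₀sq hxc hy'c, hnorm, one_smul]
  · rw [hgcoe, hG]
  · rw [hgcoe, htr, ← hcapp, map_mul, hxc, map_ofNat]
  · rw [hgcoe, htrι]
    obtain ⟨e, -, hy0⟩ := hxι ι₁
    have hlt : (ι₁ x).re * (ι₁ x).re < 1 := by
      rw [e]
      have : (ι₁ β₀).re * ((ι₁ y').re * (ι₁ y').re) < 0 := mul_neg_of_neg_of_pos hβ₀₁ (mul_self_pos.mpr hy0)
      linarith
    have habs : |(ι₁ x).re| < 1 := by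
      rw [← sq_lt_one_iff_abs_lt_one, sq]
      exact hlt
    linarith
  · rw [hgcoe, htrι]
    obtain ⟨e, -, hy0⟩ := hxι σ
    have hlt : 1 < (σ x).re * (σ x).re := by
      rw [e]
      have : 0 < (σ β₀).re * ((σ y').re * (σ y').re) := mul_pos hβ₀₂ (mul_self_pos.mpr hy0)
      linarith
    have habs : 1 < |(σ x).re| := by
      rw [← one_lt_sq_iff_one_lt_abs, sq]
      exact hlt
    linarith

/-- **Two indefinite places ⇒ the principal congruence subgroups of `U(J)` are NOT discrete at `ι₁`**: under the hypotheses
of `exists_unitary_generator_elliptic_hyperbolic`, for every `n ≠ 0` the principal congruence subgroup `Γ_J(n)` contains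
INFINITELY many elements all of whose `ι₁`-entries have norm `≤ C` (the generator's powers, ★
`infinite_setOf_mem_principalCongruenceSubgroup_norm_le_of_generator`).  Contrast: for a record system of the unitary Shimura
CURVE of `J` these sets are finite (★ `RecordSystemGS.finite_setOf_mem_norm_le_of_le_arithmeticLevel`), so no such record exists
when `J` is indefinite at a second place — the content of the E-line socket `stub_SIG` off the print signature.
[cite: Neukirch1999, Ch. I §7 Thm. (7.4) p. 42 (Dirichlet's unit theorem)]
[cite: Borel1969, §1 and Prop. 7.13] -/
theorem infinite_setOf_mem_principalCongruenceSubgroup_norm_le (ι₁ σ : F →+* ℂ) (J : Matrix (Fin 2) (Fin 2) F)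
    (hJ : (J.map (IsCMField.complexConj F))ᵀ = J) (h₁ : (J.map ι₁).det.re < 0) (h₂ : (J.map σ).det.re < 0)
    (hne : InfinitePlace.mk σ ≠ InfinitePlace.mk ι₁) {n : ℕ} (hn : n ≠ 0) :
    ∃ C : ℝ, {γ : GL (Fin 2) F |
      γ ∈ principalCongruenceSubgroup ((IsCMField.complexConj F : F ≃ₐ[↥(maximalRealSubfield F)] F) : F →+* F) J n ∧
        ∀ i j, ‖ι₁ ((γ : Matrix (Fin 2) (Fin 2) F) i j)‖ ≤ C}.Infinite := by
  obtain ⟨g, G, hgU, hG, hdet, htr, hell, hhyp⟩ := exists_unitary_generator_elliptic_hyperbolic F ι₁ σ J hJ h₁ h₂ hne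
  exact infinite_setOf_mem_principalCongruenceSubgroup_norm_le_of_generator F ι₁ σ J g hgU G hG hdet htr hell hhyp hn

end Generator

end TwoIndefinitePlaces

end UnitaryGroup

end Literature.NumberTheory.Automorphic

end
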